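import Literature.Analysis.FluidPDE.CollisionalTransferFunctional
import Literature.Analysis.FluidPDE.CollisionalTransferMeasurable
import Literature.Analysis.FluidPDE.CollisionalTransferFunctionalMeasurable
import Literature.MathematicalPhysics.KineticTheory.HardSphereEulerProofs
import Summits.AtomisticToContinuum.HydrodynamicLimit.Theorems.JParityClosureAssemblyEnergyModulus
import HarnessLib

/-!
# Stub CE `stub_collisionalEnergyCurrentClosure` of crux `MeanFluxClosure`
# (stmt-AtomisticToContinuum-9256, route AnnealedZeroHorizon, line `registered`): the EOS-free parts

The stub asks that `c W^e_ψ + J^e_ψ − I^e_ψ` (`c = (N+1)⁻¹`, `W^e_ψ` the collisional energy transfer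
of the time-`t₁` point over `(0, t₂ − t₁]`, `J^e_ψ`/`I^e_ψ` the ideal/full enthalpy-flux integrals of
the mollified fields) be integrable with small mean under the local Gibbs law. Its `I^e` part carries
the hard-sphere equation of state at uncontrolled local packing; this file proves the EOS-free parts
of the collisional term: (i) the **second-order Taylor estimate on the flat torus**
`|ψ(y + n) − ψ(y) − Dψ(y) n| ≤ ½‖D²ψ‖_∞|n|²` and its symmetrised form with the minimal-image
separation `x ⊖ y`; (ii) the **pathwise CONTACT form** of the collisional energy transfer along a
hard-sphere trajectory on `𝕋ᵈ` (`ε < 1/2`): `W^e_ψ(a, b] = Σ_{t_c} ½(Dψ(x_i) + Dψ(x_j))(x_i ⊖ x_j) ΔE_i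
+ Rem`, `|Rem| ≤ ‖D²ψ‖_∞ ε² · ¼ 𝒮ᴱ(a, b]`, the leading term being the collision-indexed functional with
the *contact kernel* `(i, j, z⁻, z⁺) ↦ ½ Dψ(x_i)(x_i ⊖ x_j) ΔE_i`, `ΔE_i = (|v_i⁺|² − |v_i⁻|²)/2`
(energy analogue of the virial kernel; Spohn 1991 (3.8) for hard spheres) and `𝒮ᴱ` the windowed
absolute energy-jump functional of stub FLUX (kernel `|Δ|v_i|²|/2`); (iii) **measurability** of the
contact functional in the datum (collision sum of a continuous mark function); (iv) **conditional
integrability**: if the FLUX functional `Q = ε c 𝒮ᴱ(Φ_{t₁} z)(0, τ]` is integrable under a law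
`μ ≪` Liouville then `c W^e_ψ` is integrable with `∫|c W^e_ψ| ≤ ½‖Dψ‖_∞ ∫ Q` and the contact
remainder with `∫|c Rem| ≤ ¼‖D²ψ‖_∞ ε ∫ Q` (`O(σ_N)` × the FLUX mean at fixed reduced density);
local-Gibbs form `integrable_avg_energyTransfer_flow_localGibbs` in the stub's vocabulary. References: Spohn
1991 Part I §3.2 (3.8), (3.15); Soto 2016 §4.8.1 (collisional transfer).
-/

noncomputable section

namespace Summit.AtomisticToContinuum.HydrodynamicLimit.Theorems

open scoped BigOperators ENNReal Topology InnerProductSpace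
open MeasureTheory Set Filter Function
open Literature.MathematicalPhysics.KineticTheory Literature.Analysis.FluidPDE
open Literature.Analysis.FunctionSpaces
open Summit.AtomisticToContinuum.HydrodynamicLimit.Theorems.JParityClosureMomentumModulus
open Summit.AtomisticToContinuum.HydrodynamicLimit.Theorems.JParityClosureEnergyModulus

namespace CollisionalEnergyCurrentClosure

/-- **Second-order Taylor estimate in a normed space**: if `g` is `C²` with `‖D²g‖ ≤ C`, then
`‖g v − g 0 − Dg(0) v‖ ≤ (C/2)‖v‖²` (mean-value inequality for `Dg`, boundary-function MVT). [folklore] -/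
theorem norm_sub_sub_fderiv_le {E F : Type*} [NormedAddCommGroup E] [NormedSpace ℝ E]
    [NormedAddCommGroup F] [NormedSpace ℝ F] {g : E → F} (hg : ContDiff ℝ 2 g) {C : ℝ}
    (hC : ∀ w, ‖fderiv ℝ (fderiv ℝ g) w‖ ≤ C) (v : E) :
    ‖g v - g 0 - fderiv ℝ g 0 v‖ ≤ C / 2 * ‖v‖ ^ 2 := by
  have hd : Differentiable ℝ g := hg.differentiable two_ne_zero
  have hd' : Differentiable ℝ (fderiv ℝ g) :=
    (hg.fderiv_right (m := 1) one_add_one_eq_two.le).differentiable one_ne_zero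
  set L : E →L[ℝ] F := fderiv ℝ g 0 with hL
  have hφ : ∀ s : ℝ, HasDerivAt (fun s : ℝ => g (s • v) - s • L v - g 0)
      (fderiv ℝ g (s • v) v - L v) s := fun s => by
    have h1 : HasDerivAt (fun s : ℝ => s • v) v s := by simpa using (hasDerivAt_id s).smul_const v
    have h2 : HasDerivAt (fun s : ℝ => g (s • v)) (fderiv ℝ g (s • v) v) s :=
      (hd (s • v)).hasFDerivAt.comp_hasDerivAt s h1
    have h3 : HasDerivAt (fun s : ℝ => s • L v) (L v) s := by simpa using (hasDerivAt_id s).smul_const (L v)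
    exact (h2.sub h3).sub_const (g 0)
  have hbound : ∀ s ∈ Ico (0 : ℝ) 1, ‖fderiv ℝ g (s • v) v - L v‖ ≤ C * ‖v‖ ^ 2 * s := fun s hs => by
    have hmvt : ‖fderiv ℝ g (s • v) - fderiv ℝ g 0‖ ≤ C * ‖s • v - 0‖ :=
      Convex.norm_image_sub_le_of_norm_fderiv_le (fun x _ => hd' x) (fun x _ => hC x)
        convex_univ (mem_univ _) (mem_univ _)
    rw [sub_zero, norm_smul, Real.norm_eq_abs, abs_of_nonneg hs.1] at hmvt
    calc ‖fderiv ℝ g (s • v) v - L v‖ = ‖(fderiv ℝ g (s • v) - fderiv ℝ g 0) v‖ := by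
          rw [hL, _root_.sub_apply]
      _ ≤ ‖fderiv ℝ g (s • v) - fderiv ℝ g 0‖ * ‖v‖ := ContinuousLinearMap.le_opNorm _ _
      _ ≤ C * (s * ‖v‖) * ‖v‖ := mul_le_mul_of_nonneg_right hmvt (norm_nonneg _)
      _ = C * ‖v‖ ^ 2 * s := by ring
  have hB : ∀ x : ℝ, HasDerivAt (fun s : ℝ => C / 2 * ‖v‖ ^ 2 * (s * s)) (C * ‖v‖ ^ 2 * x) x :=
    fun x => (((hasDerivAt_id' x).mul (hasDerivAt_id' x)).const_mul (C / 2 * ‖v‖ ^ 2)).congr_deriv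
      (by ring)
  have key := image_norm_le_of_norm_deriv_right_le_deriv_boundary
    (f := fun s : ℝ => g (s • v) - s • L v - g 0) (a := 0) (b := 1)
    (fun x _ => (hφ x).continuousAt.continuousWithinAt)
    (fun x _ => (hφ x).hasDerivWithinAt) (B := fun s : ℝ => C / 2 * ‖v‖ ^ 2 * (s * s))
    (by simp) hB hbound (right_mem_Icc.2 zero_le_one)
  simpa only [one_smul, mul_one, sub_right_comm] using key

variable {d : Type*} [Fintype d]

/-- The torus derivative of a `C²` map is `C¹`. [folklore] -/
theorem isContDiff_one_torusFderiv {F : Type*} [NormedAddCommGroup F] [NormedSpace ℝ F]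
    {ψ : UnitAddTorus d → F} (hψ : Torus.IsContDiff 2 ψ) : Torus.IsContDiff 1 (Torus.fderiv ψ) := by
  unfold Torus.IsContDiff
  rw [show Torus.lift (Torus.fderiv ψ) = fderiv ℝ (Torus.lift ψ) from
    funext fun y => (Torus.fderiv_lift ψ y).symm]
  exact hψ.fderiv_right one_add_one_eq_two.le

/-- A `C²` map on the (compact) torus has bounded second derivative `D²ψ = D(Dψ)`. [folklore] -/
theorem exists_fderiv_fderiv_le {F : Type*} [NormedAddCommGroup F] [NormedSpace ℝ F]
    {ψ : UnitAddTorus d → F} (hψ : Torus.IsContDiff 2 ψ) :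
    ∃ C : ℝ, 0 ≤ C ∧ ∀ x, ‖Torus.fderiv (Torus.fderiv ψ) x‖ ≤ C :=
  exists_fderiv_le (isContDiff_one_torusFderiv hψ)

/-- **Second-order Taylor estimate on the flat torus**: for a `C²` map `ψ` with `‖D²ψ‖ ≤ C`,
`‖ψ(y + proj n) − ψ(y) − Dψ(y) n‖ ≤ (C/2)‖n‖²` for every `y ∈ 𝕋ᵈ` and EVERY `n ∈ ℝᵈ` (the chart
`v ↦ y + proj v` is global; `liftAt (Dψ) y = D(liftAt ψ y)` by `Torus.fderiv_add_proj`). [folklore] -/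
theorem norm_sub_sub_torusFderiv_le {F : Type*} [NormedAddCommGroup F] [NormedSpace ℝ F]
    {ψ : UnitAddTorus d → F} (hψ : Torus.IsContDiff 2 ψ) {C : ℝ}
    (hC : ∀ x, ‖Torus.fderiv (Torus.fderiv ψ) x‖ ≤ C) (y : UnitAddTorus d)
    (n : EuclideanSpace ℝ d) :
    ‖ψ (y + Torus.proj n) - ψ y - Torus.fderiv ψ y n‖ ≤ C / 2 * ‖n‖ ^ 2 := by
  have e : Torus.liftAt (Torus.fderiv ψ) y = fderiv ℝ (Torus.liftAt ψ y) :=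
    funext fun w => Torus.fderiv_add_proj ψ y w
  have hC' : ∀ w, ‖fderiv ℝ (fderiv ℝ (Torus.liftAt ψ y)) w‖ ≤ C := fun w => by
    rw [← e, ← Torus.fderiv_add_proj (Torus.fderiv ψ) y w]
    exact hC _
  have key := norm_sub_sub_fderiv_le (hψ.liftAt y) hC' n
  rwa [Torus.liftAt_apply_zero ψ y] at key

/-- **Symmetrised (trapezoidal) second-order estimate on the torus**: for `x, y ∈ 𝕋ᵈ` with
minimal-image separation `n = x ⊖ y` (`sepVec`), `|ψ x − ψ y − ½(Dψ x + Dψ y) n| ≤ (C/2)‖n‖²`. [folklore] -/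
theorem abs_sub_sub_half_fderiv_add_le {ψ : UnitAddTorus d → ℝ} (hψ : Torus.IsContDiff 2 ψ)
    {C : ℝ} (hC : ∀ x, ‖Torus.fderiv (Torus.fderiv ψ) x‖ ≤ C) (x y : UnitAddTorus d) :
    |ψ x - ψ y - 2⁻¹ * (Torus.fderiv ψ x + Torus.fderiv ψ y) ((Torus.geometry d).sepVec x y)| ≤
      C / 2 * ‖(Torus.geometry d).sepVec x y‖ ^ 2 := by
  set n : EuclideanSpace ℝ d := (Torus.geometry d).sepVec x y with hn
  have hxy : y + Torus.proj n = x := by rw [hn, Torus.geometry_sepVec, Torus.proj_reprSym]; abel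
  have hyx : x + Torus.proj (-n) = y := by rw [Torus.proj_neg, ← hxy]; abel
  have h1 : |ψ x - ψ y - Torus.fderiv ψ y n| ≤ C / 2 * ‖n‖ ^ 2 := by
    have := norm_sub_sub_torusFderiv_le hψ hC y n
    rwa [hxy, Real.norm_eq_abs] at this
  have h2 : |ψ y - ψ x + Torus.fderiv ψ x n| ≤ C / 2 * ‖n‖ ^ 2 := by
    have := norm_sub_sub_torusFderiv_le hψ hC x (-n)
    rwa [hyx, map_neg, sub_neg_eq_add, norm_neg, Real.norm_eq_abs] at this
  rw [_root_.add_apply]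
  have e : ψ x - ψ y - 2⁻¹ * (Torus.fderiv ψ x n + Torus.fderiv ψ y n) =
      2⁻¹ * ((ψ x - ψ y - Torus.fderiv ψ y n) - (ψ y - ψ x + Torus.fderiv ψ x n)) := by ring
  rw [e, abs_mul, abs_of_pos (by norm_num : (0 : ℝ) < 2⁻¹)]
  linarith [abs_sub (ψ x - ψ y - Torus.fderiv ψ y n) (ψ y - ψ x + Torus.fderiv ψ x n)]

variable {ε : ℝ} {N : ℕ} {γ : ℝ → Config N d (UnitAddTorus d)}

/-- **The contact kernel at a collision** of `{i, j}` on `𝕋ᵈ` (`ε < 1/2`): both orientations of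
`(i, j) ↦ ½ Dψ(x_i)(x_i ⊖ x_j) ΔE_i` add up to `½(Dψ(x_i) + Dψ(x_j))(n) ΔE_i`, `n = x_i ⊖ x_j = −(x_j ⊖ x_i)`,
`ΔE_i = (|v_i⁺|² − |v_i⁻|²)/2 = −ΔE_j` (pair energy conservation). [folklore] -/
theorem sum_collidingPairs_contactKernel (hε : ε < 2⁻¹)
    (h : IsHardSphereTrajectory (Torus.geometry d) ε N γ) {t : ℝ} {i j : Fin N} (hij : i ≠ j)
    (hc : γ t ∈ contactSet (Torus.geometry d) N ε i j) (ψ : UnitAddTorus d → ℝ) :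
    ∑ p ∈ collidingPairs (Torus.geometry d) ε (γ t),
        2⁻¹ * (Torus.fderiv ψ (γ t p.1).1 ((Torus.geometry d).sepVec (γ t p.1).1 (γ t p.2).1) *
          ((‖(γ t p.1).2‖ ^ 2 - ‖(leftLim γ t p.1).2‖ ^ 2) / 2)) =
      2⁻¹ * (Torus.fderiv ψ (γ t i).1 + Torus.fderiv ψ (γ t j).1)
          ((Torus.geometry d).sepVec (γ t i).1 (γ t j).1) *
        ((‖(γ t i).2‖ ^ 2 - ‖(leftLim γ t i).2‖ ^ 2) / 2) := by
  have hG := Torus.isHardSphereRegular_geometry (d := d) hε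
  have hE := h.norm_sq_vel_add_eq_leftLim hij hc
  rw [h.sum_collidingPairs_eq hij hc]
  dsimp only
  rw [hG.sepVec_comm _ _ hc.2.le, map_neg, _root_.add_apply]
  have hEj : ‖(γ t j).2‖ ^ 2 - ‖(leftLim γ t j).2‖ ^ 2 =
      -(‖(γ t i).2‖ ^ 2 - ‖(leftLim γ t i).2‖ ^ 2) := by linarith
  rw [hEj]
  ring

/-- **Per collision**: the pair form `(ψ(x_i) − ψ(x_j)) ΔE_i` of the energy jump minus the contact
form `½(Dψ(x_i) + Dψ(x_j))(n) ΔE_i` is at most `(C/2) ε² |ΔE_i| = C ε² ¼ (|ΔE_i| + |ΔE_j|)`. [folklore] -/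
theorem abs_collisionJump_sub_contact_le (hε : ε < 2⁻¹)
    (h : IsHardSphereTrajectory (Torus.geometry d) ε N γ) {ψ : UnitAddTorus d → ℝ}
    (hψ : Torus.IsContDiff 2 ψ) {C : ℝ} (hC : ∀ x, ‖Torus.fderiv (Torus.fderiv ψ) x‖ ≤ C)
    {t : ℝ} {i j : Fin N} (hij : i ≠ j) (hc : γ t ∈ contactSet (Torus.geometry d) N ε i j) :
    |collisionJump (energyObservable ψ) γ t -
        ∑ p ∈ collidingPairs (Torus.geometry d) ε (γ t),
          2⁻¹ * (Torus.fderiv ψ (γ t p.1).1 ((Torus.geometry d).sepVec (γ t p.1).1 (γ t p.2).1) *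
            ((‖(γ t p.1).2‖ ^ 2 - ‖(leftLim γ t p.1).2‖ ^ 2) / 2))| ≤
      C * ε ^ 2 * (4⁻¹ * ∑ p ∈ collidingPairs (Torus.geometry d) ε (γ t),
        |‖(γ t p.1).2‖ ^ 2 - ‖(leftLim γ t p.1).2‖ ^ 2| / 2) := by
  have hG' : ∀ x : UnitAddTorus d, Continuous ((Torus.geometry d).translate x) := fun x =>
    continuous_const.add Torus.continuous_proj
  have hE := h.norm_sq_vel_add_eq_leftLim hij hc
  have hεn : ‖(Torus.geometry d).sepVec (γ t i).1 (γ t j).1‖ = ε := (mem_contactSet.1 hc).2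
  have hT := abs_sub_sub_half_fderiv_add_le hψ hC (γ t i).1 (γ t j).1
  rw [hεn] at hT
  rw [h.collisionJump_energyObservable hG' ψ hij hc, sum_collidingPairs_contactKernel hε h hij hc ψ,
    h.sum_collidingPairs_eq hij hc]
  dsimp only
  have hEj : |‖(γ t j).2‖ ^ 2 - ‖(leftLim γ t j).2‖ ^ 2| =
      |‖(γ t i).2‖ ^ 2 - ‖(leftLim γ t i).2‖ ^ 2| := by
    rw [show ‖(γ t j).2‖ ^ 2 - ‖(leftLim γ t j).2‖ ^ 2 =
      -(‖(γ t i).2‖ ^ 2 - ‖(leftLim γ t i).2‖ ^ 2) by linarith, abs_neg]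
  rw [hEj, ← sub_mul, abs_mul, abs_div, abs_two]
  refine (mul_le_mul_of_nonneg_right hT (by positivity)).trans_eq ?_
  ring

/-- **Contact form of the collisional energy transfer along a hard-sphere trajectory on `𝕋ᵈ`**
(`ε < 1/2`, `ψ ∈ C²`, `‖D²ψ‖ ≤ C`): over any window `(a, b]`,
`|W^e_ψ(a, b] − Σ_{t_c} Σ_{(i,j)} ½ Dψ(x_i)(x_i ⊖ x_j) ΔE_i| ≤ C ε² · ¼ 𝒮ᴱ(a, b]`, `𝒮ᴱ` the windowed
absolute energy-jump functional; the leading term is Spohn's collisional energy current (3.8). [folklore] -/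
theorem abs_energyTransfer_sub_contact_le (hε : ε < 2⁻¹)
    (h : IsHardSphereTrajectory (Torus.geometry d) ε N γ) {ψ : UnitAddTorus d → ℝ}
    (hψ : Torus.IsContDiff 2 ψ) {C : ℝ} (hC : ∀ x, ‖Torus.fderiv (Torus.fderiv ψ) x‖ ≤ C)
    (a b : ℝ) :
    |collisionalTransfer (Torus.geometry d) ε (energyObservable ψ) γ a b -
        collisionalTransferFunctional (Torus.geometry d) ε
          (fun (i j : Fin N) (pre post : Config N d (UnitAddTorus d)) =>
            2⁻¹ * (Torus.fderiv ψ (post i).1 ((Torus.geometry d).sepVec (post i).1 (post j).1) *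
              ((‖(post i).2‖ ^ 2 - ‖(pre i).2‖ ^ 2) / 2))) γ a b| ≤
      C * ε ^ 2 * (4⁻¹ * collisionalTransferFunctional (Torus.geometry d) ε
        (fun (i _j : Fin N) (pre post : Config N d (UnitAddTorus d)) =>
          |‖(post i).2‖ ^ 2 - ‖(pre i).2‖ ^ 2| / 2) γ a b) := by
  have hfin := h.finite_collisionTimes_inter_Ioc a b
  rw [collisionalTransfer_eq_sum _ hfin, collisionalTransferFunctional_eq_sum _ hfin,
    collisionalTransferFunctional_eq_sum _ hfin, ← Finset.sum_sub_distrib, Finset.mul_sum,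
    Finset.mul_sum]
  refine (Finset.abs_sum_le_sum_abs _ _).trans (Finset.sum_le_sum fun t ht => ?_)
  obtain ⟨i, j, hij, hc⟩ := mem_collisionTimes.1 (hfin.mem_toFinset.1 ht).1
  exact abs_collisionJump_sub_contact_le hε h hψ hC hij hc

/-- **Contact form along a hard-sphere flow** (good datum `z`, window `(0, τ]` of the time-`t₁`
point): `|W^e_ψ(Φ_{t₁} z, τ) − W^{contact}_ψ(Φ_{t₁} z, τ)| ≤ ‖D²ψ‖_∞ ε² · ¼ 𝒮ᴱ(Φ_{t₁} z, τ)`. [folklore] -/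
theorem abs_energyTransfer_flow_sub_contact_le (Φ : HardSphereFlow (Torus.geometry d) ε N)
    (hε : ε < 2⁻¹) {ψ : UnitAddTorus d → ℝ} (hψ : Torus.IsContDiff 2 ψ) {C : ℝ}
    (hC : ∀ x, ‖Torus.fderiv (Torus.fderiv ψ) x‖ ≤ C) {z : Config N d (UnitAddTorus d)}
    (hz : z ∈ Φ.good) (t₁ τ : ℝ) :
    |Φ.energyTransfer ψ (Φ.flow t₁ z) τ -
        Φ.collisionalTransferFunctional
          (fun (i j : Fin N) (pre post : Config N d (UnitAddTorus d)) =>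
            2⁻¹ * (Torus.fderiv ψ (post i).1 ((Torus.geometry d).sepVec (post i).1 (post j).1) *
              ((‖(post i).2‖ ^ 2 - ‖(pre i).2‖ ^ 2) / 2))) (Φ.flow t₁ z) τ| ≤
      C * ε ^ 2 * (4⁻¹ * Φ.collisionalTransferFunctional
        (fun (i _j : Fin N) (pre post : Config N d (UnitAddTorus d)) =>
          |‖(post i).2‖ ^ 2 - ‖(pre i).2‖ ^ 2| / 2) (Φ.flow t₁ z) τ) :=
  abs_energyTransfer_sub_contact_le hε (Φ.isTrajectory _ (Φ.mapsTo_good t₁ hz)) hψ hC 0 τ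

/-- **The contact functional as a collision sum** of the continuous mark function
`(t, x, ω, v, w) ↦ ½ Dψ(x)(ε ω) (|v − ⟪v − w, ω⟫ω|² − |v|²)/2` (`x_i ⊖ x_j = ε ω`). [folklore] -/
theorem contactFunctional_eq_collisionSum (hε : ε < 2⁻¹)
    (h : IsHardSphereTrajectory (Torus.geometry d) ε N γ) (ψ : UnitAddTorus d → ℝ) (a b : ℝ) :
    collisionalTransferFunctional (Torus.geometry d) ε
        (fun (i j : Fin N) (pre post : Config N d (UnitAddTorus d)) =>
          2⁻¹ * (Torus.fderiv ψ (post i).1 ((Torus.geometry d).sepVec (post i).1 (post j).1) *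
            ((‖(post i).2‖ ^ 2 - ‖(pre i).2‖ ^ 2) / 2))) γ a b =
      collisionSum (Torus.geometry d) ε γ (Ioc a b) fun c =>
        (fun m : ℝ × UnitAddTorus d × EuclideanSpace ℝ d × EuclideanSpace ℝ d ×
            EuclideanSpace ℝ d =>
          2⁻¹ * (Torus.fderiv ψ m.2.1 (ε • m.2.2.1) *
            ((‖m.2.2.2.1 - ⟪m.2.2.2.1 - m.2.2.2.2, m.2.2.1⟫_ℝ • m.2.2.1‖ ^ 2 -
              ‖m.2.2.2.1‖ ^ 2) / 2))) c.mark := by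
  have hG := Torus.isHardSphereRegular_geometry (d := d) hε
  refine collisionalTransferFunctional_eq_collisionSum hG fun t _ p hp => ?_
  simp only [HardSphereCollisionRecord.mark_def, HardSphereCollisionRecord.ofConfig_fstPos]
  rw [← h.vel_eq_preVel_sub_inner_smul_impactVec hG hp, h.ofConfig_preVel_eq_leftLim hp,
    ← sepVec_eq_smul_impactVec hp]

/-- **Measurability of the contact functional in the datum** on `𝕋ᵈ` (`ε < 1/2`, `ψ ∈ C¹`):
`z ↦ W^{contact}_ψ(z, τ)`, extended by `0` off the good set, is measurable. [folklore] -/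
theorem measurable_indicator_contactFunctional (Φ : HardSphereFlow (Torus.geometry d) ε N)
    (hε : ε < 2⁻¹) {ψ : UnitAddTorus d → ℝ} (hψ : Torus.IsContDiff 1 ψ) (τ : ℝ) :
    Measurable (Φ.good.indicator fun z => Φ.collisionalTransferFunctional
      (fun (i j : Fin N) (pre post : Config N d (UnitAddTorus d)) =>
        2⁻¹ * (Torus.fderiv ψ (post i).1 ((Torus.geometry d).sepVec (post i).1 (post j).1) *
          ((‖(post i).2‖ ^ 2 - ‖(pre i).2‖ ^ 2) / 2))) z τ) := by
  have hD := Torus.continuous_fderiv hψ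
  have hf : Continuous fun m : ℝ × UnitAddTorus d × EuclideanSpace ℝ d × EuclideanSpace ℝ d ×
      EuclideanSpace ℝ d => 2⁻¹ * (Torus.fderiv ψ m.2.1 (ε • m.2.2.1) *
        ((‖m.2.2.2.1 - ⟪m.2.2.2.1 - m.2.2.2.2, m.2.2.1⟫_ℝ • m.2.2.1‖ ^ 2 - ‖m.2.2.2.1‖ ^ 2) / 2)) := by
    fun_prop
  exact Φ.measurable_indicator_of_eqOn_collisionSum (Torus.isHardSphereRegular_geometry hε)
    Torus.isMeasurable_geometry hf hf.measurable τ fun z hz =>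
    contactFunctional_eq_collisionSum hε (Φ.isTrajectory z hz) ψ 0 τ

/-- **Window functionals of the time-`t₁` point are a.e.-measurable**: if `W`, extended by `0`
off the good set, is measurable, then `z ↦ W(Φ_{t₁} z)` is a.e.-measurable under every law carried
by the (invariant) good set. [folklore] -/
theorem aemeasurable_comp_flow {X : Type*} [MeasureSpace X] [TopologicalSpace X]
    {G : Geometry d X} (Φ : HardSphereFlow G ε N) {β : Type*} [MeasurableSpace β] [Zero β]
    {W : Config N d X → β} (hW : Measurable (Φ.good.indicator W)) (t₁ : ℝ)
    {μ : Measure (Config N d X)} (hμ : μ Φ.goodᶜ = 0) :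
    AEMeasurable (fun z => W (Φ.flow t₁ z)) μ := by
  refine ⟨fun z => Φ.good.indicator W (Φ.flow t₁ z), hW.comp (Φ.measurable_flow t₁), ?_⟩
  have hae : ∀ᵐ z ∂μ, z ∈ Φ.good := by rw [ae_iff]; exact hμ
  filter_upwards [hae] with z hz
  exact (indicator_of_mem (Φ.mapsTo_good t₁ hz) W).symm

/-- The collisional energy transfer of the time-`t₁` point over `(0, τ]` is a.e.-measurable under
every law absolutely continuous w.r.t. the Liouville measure (`C¹` test function). [folklore] -/
theorem aemeasurable_energyTransfer_flow (Φ : HardSphereFlow (Torus.geometry d) ε N)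
    {ψ : UnitAddTorus d → ℝ} (hψ : Torus.IsContDiff 1 ψ) (t₁ τ : ℝ)
    {μ : Measure (Config N d (UnitAddTorus d))} (hμ : μ ≪ liouville (Torus.geometry d) N ε) :
    AEMeasurable (fun z => Φ.energyTransfer ψ (Φ.flow t₁ z) τ) μ :=
  aemeasurable_comp_flow Φ (Φ.measurable_indicator_energyTransfer_torus hψ τ) t₁
    (Φ.measure_compl_good_of_absolutelyContinuous hμ)

/-- Domination bookkeeping: if `‖F‖ ≤ K Q` a.e. with `Q` integrable and `F` a.e.-strongly
measurable, then `F` is integrable and `∫ |F| ≤ K ∫ Q`. [folklore] -/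
theorem integrable_and_integral_abs_le_of_dominated {α : Type*} [MeasurableSpace α]
    {μ : Measure α} {F Q : α → ℝ} {K : ℝ} (hF : AEStronglyMeasurable F μ) (hQ : Integrable Q μ)
    (hdom : ∀ᵐ z ∂μ, ‖F z‖ ≤ K * Q z) : Integrable F μ ∧ ∫ z, |F z| ∂μ ≤ K * ∫ z, Q z ∂μ := by
  have hint : Integrable F μ := (hQ.const_mul K).mono' hF hdom
  refine ⟨hint, ?_⟩
  calc ∫ z, |F z| ∂μ = ∫ z, ‖F z‖ ∂μ := by simp only [Real.norm_eq_abs]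
    _ ≤ ∫ z, K * Q z ∂μ := integral_mono_ae hint.norm (hQ.const_mul _) hdom
    _ = K * ∫ z, Q z ∂μ := integral_const_mul _ _

/-- **Conditional integrability of the collisional energy transfer.** For `ψ ∈ C¹` with
`‖Dψ‖ ≤ L`, a law `μ ≪` Liouville and `c ≥ 0`: if the FLUX functional `ε c 𝒮ᴱ(Φ_{t₁} z, τ]` is
integrable then so is `c W^e_ψ(Φ_{t₁} z, τ)`, with `∫ |c W^e_ψ| dμ ≤ (L/2) ∫ ε c 𝒮ᴱ dμ`. [folklore] -/
theorem integrable_energyTransfer_flow_of_integrable_flux (Φ : HardSphereFlow (Torus.geometry d) ε N)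
    {ψ : UnitAddTorus d → ℝ} (hψ : Torus.IsContDiff 1 ψ) {L : ℝ} (hL : ∀ x, ‖Torus.fderiv ψ x‖ ≤ L)
    (t₁ τ : ℝ) {μ : Measure (Config N d (UnitAddTorus d))}
    (hμ : μ ≪ liouville (Torus.geometry d) N ε) {c : ℝ} (hc : 0 ≤ c)
    (hQ : Integrable (fun z => ε * c * Φ.collisionalTransferFunctional
      (fun (i _j : Fin N) (pre post : Config N d (UnitAddTorus d)) =>
        |‖(post i).2‖ ^ 2 - ‖(pre i).2‖ ^ 2| / 2) (Φ.flow t₁ z) τ) μ) :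
    Integrable (fun z => c * Φ.energyTransfer ψ (Φ.flow t₁ z) τ) μ ∧
      ∫ z, |c * Φ.energyTransfer ψ (Φ.flow t₁ z) τ| ∂μ ≤
        L / 2 * ∫ z, ε * c * Φ.collisionalTransferFunctional
          (fun (i _j : Fin N) (pre post : Config N d (UnitAddTorus d)) =>
            |‖(post i).2‖ ^ 2 - ‖(pre i).2‖ ^ 2| / 2) (Φ.flow t₁ z) τ ∂μ := by
  refine integrable_and_integral_abs_le_of_dominated
    ((aemeasurable_energyTransfer_flow Φ hψ t₁ τ hμ).const_mul c).aestronglyMeasurable hQ ?_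
  filter_upwards [hμ.ae_le Φ.ae_mem_good] with z hz
  have hb := abs_energyTransfer_le (Φ.isTrajectory _ (Φ.mapsTo_good t₁ hz))
    (norm_sub_le_of_fderiv_le hψ hL) 0 τ
  rw [Real.norm_eq_abs, abs_mul, abs_of_nonneg hc]
  refine (mul_le_mul_of_nonneg_left hb hc).trans_eq ?_
  change c * (L * ε * (2⁻¹ * Φ.collisionalTransferFunctional
    (fun (i _j : Fin N) (pre post : Config N d (UnitAddTorus d)) =>
      |‖(post i).2‖ ^ 2 - ‖(pre i).2‖ ^ 2| / 2) (Φ.flow t₁ z) τ)) = _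
  ring

/-- **The contact remainder is integrable and `O(ε)` in mean relative to the FLUX functional**:
for `ψ ∈ C²` with `‖D²ψ‖ ≤ C`, `ε < 1/2`, a law `μ ≪` Liouville and `c ≥ 0`, if `ε c 𝒮ᴱ(Φ_{t₁} z, τ]`
is integrable then `c Rem = c (W^e_ψ − W^{contact}_ψ)` is, with `∫ |c Rem| ≤ (C ε/4) ∫ ε c 𝒮ᴱ`. [folklore] -/
theorem integrable_contactRemainder_of_integrable_flux (Φ : HardSphereFlow (Torus.geometry d) ε N)
    (hε : ε < 2⁻¹) {ψ : UnitAddTorus d → ℝ} (hψ : Torus.IsContDiff 2 ψ) {C : ℝ}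
    (hC : ∀ x, ‖Torus.fderiv (Torus.fderiv ψ) x‖ ≤ C) (t₁ τ : ℝ)
    {μ : Measure (Config N d (UnitAddTorus d))} (hμ : μ ≪ liouville (Torus.geometry d) N ε)
    {c : ℝ} (hc : 0 ≤ c)
    (hQ : Integrable (fun z => ε * c * Φ.collisionalTransferFunctional
      (fun (i _j : Fin N) (pre post : Config N d (UnitAddTorus d)) =>
        |‖(post i).2‖ ^ 2 - ‖(pre i).2‖ ^ 2| / 2) (Φ.flow t₁ z) τ) μ) :
    Integrable (fun z => c * (Φ.energyTransfer ψ (Φ.flow t₁ z) τ -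
        Φ.collisionalTransferFunctional
          (fun (i j : Fin N) (pre post : Config N d (UnitAddTorus d)) =>
            2⁻¹ * (Torus.fderiv ψ (post i).1 ((Torus.geometry d).sepVec (post i).1 (post j).1) *
              ((‖(post i).2‖ ^ 2 - ‖(pre i).2‖ ^ 2) / 2))) (Φ.flow t₁ z) τ)) μ ∧
      ∫ z, |c * (Φ.energyTransfer ψ (Φ.flow t₁ z) τ -
        Φ.collisionalTransferFunctional
          (fun (i j : Fin N) (pre post : Config N d (UnitAddTorus d)) =>
            2⁻¹ * (Torus.fderiv ψ (post i).1 ((Torus.geometry d).sepVec (post i).1 (post j).1) *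
              ((‖(post i).2‖ ^ 2 - ‖(pre i).2‖ ^ 2) / 2))) (Φ.flow t₁ z) τ)| ∂μ ≤
        C * ε / 4 * ∫ z, ε * c * Φ.collisionalTransferFunctional
          (fun (i _j : Fin N) (pre post : Config N d (UnitAddTorus d)) =>
            |‖(post i).2‖ ^ 2 - ‖(pre i).2‖ ^ 2| / 2) (Φ.flow t₁ z) τ ∂μ := by
  have hψ1 : Torus.IsContDiff 1 ψ := hψ.of_le one_le_two
  refine integrable_and_integral_abs_le_of_dominated
    ((((aemeasurable_energyTransfer_flow Φ hψ1 t₁ τ hμ).sub (aemeasurable_comp_flow Φ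
      (measurable_indicator_contactFunctional Φ hε hψ1 τ) t₁
      (Φ.measure_compl_good_of_absolutelyContinuous hμ))).const_mul c).aestronglyMeasurable) hQ ?_
  filter_upwards [hμ.ae_le Φ.ae_mem_good] with z hz
  have hb := abs_energyTransfer_flow_sub_contact_le Φ hε hψ hC hz t₁ τ
  rw [Real.norm_eq_abs, abs_mul, abs_of_nonneg hc]
  refine (mul_le_mul_of_nonneg_left hb hc).trans_eq ?_
  ring

/-- **Conditional integrability of the stub's collisional term** `c W^e_ψ`, `c = (N+1)⁻¹`,
`W^e_ψ = (Φ N).energyTransfer ψ ((Φ N).flow t₁ z) (t₂ − t₁)`, under the local Gibbs law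
`localGibbsLaw σ a₀ u₀ θ₀ N Φ` (every profile, every `σ`): if the FLUX functional `Q = σ_N c 𝒮ᴱ` of
stub FLUX is integrable, then so is `c W^e_ψ`, with `∫ |c W^e_ψ| ≤ ½‖Dψ‖_∞ ∫ Q`. [folklore] -/
theorem integrable_avg_energyTransfer_flow_localGibbs (σ : ℝ) (a₀ θ₀ : T3 → ℝ) (u₀ : T3 → V3)
    (N : ℕ) (Φ : HardSphereFlow (Torus.geometry (Fin 3)) (hsDiameter σ N) (N + 1))
    {ψ : T3 → ℝ} (hψ : Torus.IsContDiff 1 ψ) {L : ℝ} (hL : ∀ x, ‖Torus.fderiv ψ x‖ ≤ L)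
    (t₁ t₂ : ℝ)
    (hQ : Integrable (fun z => hsDiameter σ N * ((N + 1 : ℕ) : ℝ)⁻¹ *
      Φ.collisionalTransferFunctional
        (fun (i _j : Fin (N + 1)) (pre post : Config (N + 1) (Fin 3) T3) =>
          |‖(post i).2‖ ^ 2 - ‖(pre i).2‖ ^ 2| / 2) (Φ.flow t₁ z) (t₂ - t₁))
      (localGibbsLaw σ a₀ u₀ θ₀ N Φ)) :
    Integrable (fun z => ((N + 1 : ℕ) : ℝ)⁻¹ * Φ.energyTransfer ψ (Φ.flow t₁ z) (t₂ - t₁))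
        (localGibbsLaw σ a₀ u₀ θ₀ N Φ) ∧
      ∫ z, |((N + 1 : ℕ) : ℝ)⁻¹ * Φ.energyTransfer ψ (Φ.flow t₁ z) (t₂ - t₁)|
          ∂localGibbsLaw σ a₀ u₀ θ₀ N Φ ≤
        L / 2 * ∫ z, hsDiameter σ N * ((N + 1 : ℕ) : ℝ)⁻¹ *
          Φ.collisionalTransferFunctional
            (fun (i _j : Fin (N + 1)) (pre post : Config (N + 1) (Fin 3) T3) =>
              |‖(post i).2‖ ^ 2 - ‖(pre i).2‖ ^ 2| / 2) (Φ.flow t₁ z) (t₂ - t₁)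
          ∂localGibbsLaw σ a₀ u₀ θ₀ N Φ :=
  integrable_energyTransfer_flow_of_integrable_flux Φ hψ hL t₁ (t₂ - t₁)
    (by rw [localGibbsLaw_eq]; exact localGibbsMeasure_absolutelyContinuous σ a₀ u₀ θ₀ N Φ)
    (inv_nonneg.2 (Nat.cast_nonneg _)) hQ

end CollisionalEnergyCurrentClosure

/-- **Registered-stub form (CE-int)** of `integrable_avg_energyTransfer_flow_localGibbs` (for `--supports`). [folklore] -/
theorem stub_collisionalEnergyTransferIntegrableOfFlux : ∀ (σ : ℝ) (a₀ θ₀ : Literature.MathematicalPhysics.KineticTheory.T3 → ℝ) (u₀ : Literature.MathematicalPhysics.KineticTheory.T3 → Literature.MathematicalPhysics.KineticTheory.V3) (N : ℕ) (Φ : Literature.Analysis.FluidPDE.HardSphereFlow (Literature.Analysis.FluidPDE.Torus.geometry (Fin 3)) (Literature.MathematicalPhysics.KineticTheory.hsDiameter σ N) (N + 1)) (ψ : Literature.MathematicalPhysics.KineticTheory.T3 → ℝ), Literature.Analysis.FunctionSpaces.Torus.IsContDiff 1 ψ → ∀ (L : ℝ), (∀ x, ‖Literature.Analysis.FunctionSpaces.Torus.fderiv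 ψ x‖ ≤ L) → ∀ (t₁ t₂ : ℝ), MeasureTheory.Integrable (fun z => Literature.MathematicalPhysics.KineticTheory.hsDiameter σ N * ((N + 1 : ℕ) : ℝ)⁻¹ * Φ.collisionalTransferFunctional (fun (i _j : Fin (N + 1)) (pre post : Literature.Analysis.FluidPDE.Config (N + 1) (Fin 3) Literature.MathematicalPhysics.KineticTheory.T3) => |‖(post i).2‖ ^ 2 - ‖(pre i).2‖ ^ 2| / 2) (Φ.flow t₁ z) (t₂ - t₁)) (Literature.MathematicalPhysics.KineticTheory.localGibbsLaw σ a₀ u₀ θ₀ N Φ) → MeasureTheory.Integrable (fun z => ((N + 1 : ℕ) : ℝ)⁻¹ * Φ.energyTransfer ψ (Φ.flow t₁ z) (t₂ - t₁)) (Literature.MathematicalPhysics.KineticTheory.localGibbsLaw σ a₀ u₀ θ₀ N Φ) ∧ ∫ z, |((N + 1 : ℕ) : ℝ)⁻¹ * Φ.energyTransfer ψ (Φ.flow t₁ z) (t₂ - t₁)| ∂Literature.MathematicalPhysics.KineticTheory.localGibbsLaw σ a₀ u₀ θ₀ N Φ ≤ L / 2 * ∫ z, Literature.MathematicalPhysics.KineticTheory.hsDiameter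 σ N * ((N + 1 : ℕ) : ℝ)⁻¹ * Φ.collisionalTransferFunctional (fun (i _j : Fin (N + 1)) (pre post : Literature.Analysis.FluidPDE.Config (N + 1) (Fin 3) Literature.MathematicalPhysics.KineticTheory.T3) => |‖(post i).2‖ ^ 2 - ‖(pre i).2‖ ^ 2| / 2) (Φ.flow t₁ z) (t₂ - t₁) ∂Literature.MathematicalPhysics.KineticTheory.localGibbsLaw σ a₀ u₀ θ₀ N Φ :=
  fun σ a₀ θ₀ u₀ N Φ _ψ hψ _L hL t₁ t₂ hQ =>
    CollisionalEnergyCurrentClosure.integrable_avg_energyTransfer_flow_localGibbs σ a₀ θ₀ u₀ N Φ hψ hL t₁ t₂ hQ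

end Summit.AtomisticToContinuum.HydrodynamicLimit.Theorems

end
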